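import Summits.QuantumFields.YangMills.Theorems.BalabanUVNodesN06AtRecord11ObligationsPins
import Summits.QuantumFields.YangMills.Theorems.BalabanUVNodesN06AtRecord11ObligationsHg
import Literature.MathematicalPhysics.QuantumFieldTheory.Balaban1983to89.B9Cor35ComparisonsEH
import Literature.MathematicalPhysics.QuantumFieldTheory.Balaban1983to89.B9Ineq346SecondOrderGpAtLetters
import Literature.MathematicalPhysics.QuantumFieldTheory.Balaban1983to89.B9Ineq347GAAtLetters
import Literature.MathematicalPhysics.QuantumFieldTheory.Balaban1983to89.B9Thm39ReadingAtLetters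
import Literature.MathematicalPhysics.QuantumFieldTheory.Balaban1983to89.B9Thm314Thm315RecordVacuity

/-!
# BalabanUVNodes ∕ N06 ([B9], `Dag.B9_main`) — THE SOUND CORE OF THE STAGE-11 CERTIFICATE AT THE `OpsY` INSTANCE OF RECORD:
# every row supplied ONLY through currencies no located negative touches; the rows whose displayed reading schemas are UNSATISFIABLE AS TYPED
# (13, 18–21) put back to their WHOLE operator-layer obligations until the repaired currencies land

Track A of `YM-PLAN.md` (cell `pub-ymgap`, HUMAN RULING D-0062), node **N06** = [Balaban1985BackgroundPropagators] Thms 3.1–3.15; seat `pub-ymgap-dag-n06-d`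
gen 4 (successor of the knit-at-the-instance lineage `…N06AtOpsYOfLetters*` ∕ `…N06AtOpsYOfRecord(B)`, p470041 … p488821).

WHY THIS FILE.  The certificate of record `…N06AtOpsYOfRecordB.b9_main_of_up_view₁₁B10YZW_opsYOfRecord_coGlob` (p488821, 257 binders) supplies rows 13 and 18–21 of
the 28-obligation certificate `…N06AtRecord11CB10YZW.b9_main_of_up_view₁₁B10YZW_of_obligations` (p449575) through DISPLAYED READING SCHEMAS that two kernel-checked
located negatives of the night show to be UNSATISFIABLE AS TYPED at the record's «sites = index bonds» geometry `geo9Y`: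
* seat n06-l, `B9CoRealizesSharedBlock.not_hcoGA_opsYOfRecord` (SHARED-BLOCKS memo): every co-reading `CoRealizes ((ops x).GA) n U …` quantified over `U ∋ 1` is refuted
  at EVERY member of dimension ≥ 2 (two index bonds share one carrier block; `CoRealizes.off` sends the evaluation into one fibre; `GA_one` + positivity of Δ_a⁻¹) —
  the binders `hcoA0‥3` of rows 18–19; the same one-fibre field sits in `hco0‥3` (G′), `CoRealizesH`, `L2Reads`∕`H1Reads`∕`InputReads` (rows 18–21);
* seat n06-c g3, LOCATED-4∕4b (pub-ymgap INBOX l.15289∕l.15379): the [4]-Lemma-2.1 fields `h261`∕`hST` («∀ α ∈ (0,1)») of EVERY `SectBFrame` are unsatisfiable over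
  the record family as typed — the binder `F : SectBFrame …` of row 13.
A certificate one of whose displayed hypotheses is unsatisfiable proves nothing at the instance; dag-lead WORDS-132 (3): «do NOT re-knit on the same currency».
THIS FILE is the re-knit on the SOUND currencies only.  Per row of p449575 at `ops := Node00.opsYOfRecord N θ M⋆ 𝔈` (def-Y v2's letters of record; `𝔈` free):
* rows 1–8 (`hGp_e hGp_h1 hC hGA_e hGA_h1 hGA_e4 hGA_h2 hGA_l2`) DISCHARGED — n06-f∕n06-g `B9Cor35ComparisonsGpCAtLetters.hGp_e∕h1_opsYOfLetters`, `hC_opsYOfLetters`,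
  `B9Cor35ComparisonsGAAtLetters.hGA_e∕h1∕e4∕h2∕l2_opsYOfLetters` (U = 1 comparisons, Cor. 3.5 p. 407);
* rows 9–10 (`hE4 hH2`) DISCHARGED — `B9Cor35ComparisonsEH.hE4_of_hGA_e4 ∕ hH2_of_hGA_h2`;
* row 11 (`hGp`) ⇐ the TWO input-Hölder leaves (3.44)∕(3.45) of G′(1) on site arguments (`hGpE4 : AtOneE4On …`, `hGpH2 : AtOneH2On …`) — n06-h g3
  `B9Ineq346SecondOrderGpAtLetters.hGp_opsYOfLetters_of_leaves2` (all six (3.46) members, (3.47), (3.43) PROVED at U = 1 on p21's multilevel torus);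
* row 12 (`hGA`) DISCHARGED — n06-h g2 `B9Ineq347GAAtLetters.hGA_opsYOfLetters` ((3.47) of G(1) on the block geometry);
* row 14 (`hg`) — `…ObligationsHg.hg_obligation_vacuous` (LOCATED: `not_inCubeY`, the (3.35) cube class has no member at this pin);
* rows 15–16 (`t39 hksum`) ⇐ n06-j g5 `B9Thm39ReadingAtLetters.t39_hksum_of_pins_opsYOfRecord`: Theorem-3.9 carrier letters `𝔬39 x : Ops39Blk (geo9Y x) (bg9Y …)
  (X39 M_N(ℂ) x.toKIdx) …` on the BLOCK carrier `𝔅 × (real coordinates of M_N(ℂ))`, pinned by `hblk39` (total block map `blk39`), `hL39` (`L(U)` IS the genuine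
  `(Q′G′²Q′*)(U)`, def-Y's `XY`) and `hEK39` (the expansion letter); the (3.48) reading of the genuine `C(U)` is a THEOREM there (`reading_le_of_letters`); displayed:
  the printed-shape schemas `StaticOK39Blk Locality39Blk Local348Blk Identities395Blk Small285Blk Factors389Blk` of `𝔬39` = Theorem 3.9's content, NOT asserted;
* row 17 (`t311`) ⇐ `…ObligationsPins.t311_of_pin`: Theorem-3.11 letters `𝔬311` with `Inputs311` and the pin `hPD` of the free predicate letter `PosDef` — HONEST: at
  this instance `𝔬311`'s operators are NOT pinned to def-Y's genuine `deltaPrimeAY ∕ GpY ∕ …` (n06-j g5 close, item (t3)): the row is SOUND but PADDED;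
* rows 22–26 (`t314 t314loc t315 s349 s3132`) — the LOCATED VACUITIES of n06-m g3 ∕ n06-i g4 at def-Y v2's FLAT Sect.-D∕E letters
  (`B9Thm314Thm315RecordVacuity.t314∕t314loc_opsYOfRecord_vacuous`, `t315_opsYOfRecord_of_slots hδ5 hG5 hH5`, `B9RecordDELettersVacuity.s349∕s3132_opsYOfRecord_vacuous`):
  they hold OUTRIGHT BUT VACUOUSLY there and become genuine obligations at def-Y's v3 letters (`opsYOfRecordDE`, node00-def-Y g3 FILE 7);
* ★ rows 13 (`hB`), 18–19 (`t37 c38 t310 hsum`), 20–21 (`t312 t313`) DISPLAYED AS WHOLE OPERATOR-LAYER OBLIGATIONS (p449575's binder types verbatim at the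
  instance) — NOT through `SectBFrame` ∕ `CoRealizes` ∕ `CoRealizesH` ∕ `L2Reads` ∕ `H1Reads` ∕ `InputReads` faces.  Their sound re-supply is in flight and lands as
  sequels of THIS file: row 13 ⇐ n06-c g4 `SectBFrame₂` (Lemma-2.1 fields M-thresholded and rate-capped, INTENT l.15793); rows 20–21 ⇐ n06-l g3 `CoRealizesRel`
  leaves (co-reading relative to the carrier-block equivalence `β c = β c′`, multiplicity ≤ 2(d+1), INTENT-11 l.15893); rows 18–19 ⇐ the same swap in n06-k's
  `B9RWSums*` reading layer.
WHAT IS DISPLAYED, AND NOTHING ELSE (≈ 45 binders, was 257): `hGpE4 hGpH2` (row 11) · `hB` (13) · `𝔬39 rd39` + nine reals with signs + `hst39 hloc39 h39` + pins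
`hblk39 hL39 hEK39` (15–16) · `𝔬311` + three reals + `h311` + pin `hPD` (17) · `t37 c38 t310 hsum` (18–19) · `t312 t313` (20–21) · `hδ5 hG5 hH5` (24).
NON-VACUITY STATUS (honest, per displayed class): the whole obligations and the U = 1 leaves are statements about def-Y's genuine letters ∕ the free expansion letters —
[B9]'s content, believed true, NOT proved; the `𝔬39`∕`𝔬311` schemas are printed-shape hypothesis records on free walk data (inhabited jointly only by Bałaban's
expansions); the three pins constrain the free `𝔈` and are met by choosing its fields; NO displayed binder of this file is the target of a located negative in the tree.
HONEST FRAMING.  Kernel bookkeeping over landed modules; COUNT-NEUTRAL; NOT a discharge claim — nothing of [B9] is proved for Bałaban's operators beyond the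
suppliers' U = 1 theorems; def-Y v2's Sect.-D∕E letters are flat (rows 20–26 carry no content at this instance); N06 NOT discharged.  One finite 𝕋⁴ programme at
fixed `ε` — NOT ℝ⁴ ∕ OS ∕ mass gap ∕ Clay.  0 `def`, 0 `sorry`.
-/

noncomputable section

namespace Summit.QuantumFields.YangMills.BalabanUVNodes.N06AtOpsYOfRecordSound

open Literature.MathematicalPhysics.QuantumFieldTheory.Balaban1983to89
open Literature.MathematicalPhysics.QuantumFieldTheory.Balaban1983to89.T4Continuum (T4Family)
open Literature.MathematicalPhysics.QuantumFieldTheory.Balaban1983to89.DagBinding (WorldP leavesP)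
open Literature.MathematicalPhysics.QuantumFieldTheory.Balaban1983to89.Node00
open Literature.MathematicalPhysics.QuantumFieldTheory.Balaban1983to89.B9PinMembersKLevelV1 (MemberY geo9Y bg9Y)
open Literature.MathematicalPhysics.QuantumFieldTheory.Balaban1983to89.B9PinGeometryKLevelV1 (dOmegaY OmKY inΛY unitDistY InCubeY c35Y c35Y_pos)
open Literature.MathematicalPhysics.QuantumFieldTheory.Balaban1983to89.B7Prop2SpecialUnitary (specialUnitaryUnits)
open Literature.MathematicalPhysics.QuantumFieldTheory.Balaban1983to89.B9Ineq347GAAtLetters (hGA_opsYOfLetters)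
open Literature.MathematicalPhysics.QuantumFieldTheory.Balaban1983to89.B9Ineq346SecondOrderGpAtLetters (hGp_opsYOfLetters_of_leaves2)
open Literature.MathematicalPhysics.QuantumFieldTheory.Balaban1983to89.B9ResidualEntriesAtOne (AtOneE4On AtOneH2On)
open Literature.MathematicalPhysics.QuantumFieldTheory.Balaban1983to89.B9Cor35ComparisonsGAAtLetters
  (hGA_e_opsYOfLetters hGA_h1_opsYOfLetters hGA_e4_opsYOfLetters hGA_h2_opsYOfLetters hGA_l2_opsYOfLetters)
open Literature.MathematicalPhysics.QuantumFieldTheory.Balaban1983to89.B9Cor35ComparisonsGpCAtLetters (hGp_e_opsYOfLetters hGp_h1_opsYOfLetters hC_opsYOfLetters)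
open Literature.MathematicalPhysics.QuantumFieldTheory.Balaban1983to89.B9Cor35ComparisonsEH (hE4_of_hGA_e4 hH2_of_hGA_h2)
open Literature.MathematicalPhysics.QuantumFieldTheory.Balaban1983to89.B9Thm314Thm315RecordVacuity (t314_opsYOfRecord_vacuous t314loc_opsYOfRecord_vacuous t315_opsYOfRecord_of_slots)
open Literature.MathematicalPhysics.QuantumFieldTheory.Balaban1983to89.B9RecordDELettersVacuity (s349_opsYOfRecord_vacuous s3132_opsYOfRecord_vacuous)
open Literature.MathematicalPhysics.QuantumFieldTheory.Balaban1983to89.B9Thm311Whole (Ops311 PosDefOfOps Inputs311)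
open Literature.MathematicalPhysics.QuantumFieldTheory.Balaban1983to89.B9Thm39Whole (WalkReading39)
open Literature.MathematicalPhysics.QuantumFieldTheory.Balaban1983to89.B9Thm39WholeBlk (Ops39Blk StaticOK39Blk Locality39Blk Local348Blk Identities395Blk Small285Blk Factors389Blk)
open Literature.MathematicalPhysics.QuantumFieldTheory.Balaban1983to89.B9Thm39WholeBlkViaDatum (EK39OfOpsBlkVia)
open Literature.MathematicalPhysics.QuantumFieldTheory.Balaban1983to89.B9Thm39ReadingCoords (repSite39)
open Literature.MathematicalPhysics.QuantumFieldTheory.Balaban1983to89.B9Thm39ReadingAtLetters (X39 blk39 L39 t39_hksum_of_pins_opsYOfRecord)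
open Literature.MathematicalPhysics.QuantumFieldTheory.Balaban1983to89.B9RowSum261DefiniteFaces (rowConst261)
open Summit.QuantumFields.YangMills.BalabanUVNodes.N06AtRecord11ObligationsPins (t311_of_pin)
open Summit.QuantumFields.YangMills.BalabanUVNodes.N06AtRecord11ObligationsHg (hg_obligation_vacuous)
open Summit.QuantumFields.YangMills.BalabanUVNodes.N06AtRecord11CB10YZW (b9_main_of_up_view₁₁B10YZW_of_obligations)
open scoped Matrix.Norms.L2Operator

variable {N : ℕ}

section Pointed

variable [NeZero N] {F : T4Family}

/-- **THE SOUND CORE OF THE STAGE-11 CERTIFICATE AT THE `OpsY` INSTANCE OF RECORD** (module docstring): `Dag.B9_main` at every run of a world bound over the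
four-pin Stage-11 view of `(θ, M⋆, Node00.opsYOfRecord N θ M⋆ 𝔈, ζ, λ_W)`, every `𝔈`, from: the two input-Hölder leaves (3.44)∕(3.45) of G′(1) (row 11); the
Sect.-B step predicate `hB` WHOLE (row 13); Theorem 3.9's carrier letters `𝔬39` on the block carrier with their printed-shape schemas and the pins `hblk39 hL39 hEK39`
(rows 15–16, the (3.48) reading of the genuine `C(U)` proved by n06-j); Theorem 3.11's letters `𝔬311` with `Inputs311` and the pin `hPD` (row 17); Theorems 3.7 ∕
Cor. 3.8 ∕ Thm 3.10 and the random-walk-sum predicate WHOLE (`t37 c38 t310 hsum`, rows 18–19); Theorems 3.12 ∕ 3.13 WHOLE (`t312 t313`, rows 20–21); the two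
Thm-3.15 expansion-letter slots + `0 < δ5` (row 24).  Rows 1–10, 12, 14, 22–23, 25–26 are discharged ∕ located-vacuous by name.  NO `SectBFrame`, NO
`CoRealizes`-type co-reading is displayed (both classes carry located negatives at this geometry).  NOT a discharge of N06.
[cite: Balaban1985BackgroundPropagators, Thms 3.1–3.15 pp.397–432, Cor. 3.5 p.407, Thm 3.9 (3.98)–(3.99) p.413, Thm 3.2 (3.48) p.398, Thm 3.11 p.417, Sect. B
pp.400–407; Balaban1984PropagatorsII, Lemma 2.1 (2.60)–(2.61) pp.233–234] -/
theorem b9_main_of_up_view₁₁B10YZW_opsYOfRecord_sound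
    (θ : Stage11Params F N) (hθ : θ.Admissible) (Mstar : ℕ) (𝔈 : ExpsY N θ.toStage3Params Mstar) (ζ : ResidZ F N) (lamW : ResidW F N) (w : WorldP)
    (hup : ∀ P, w.up P = upOfRecord₅C F N (θ.view₁₁B10YZW F N Mstar (opsYOfRecord N θ.toStage3Params Mstar 𝔈) ζ lamW) P)
    [∀ x : MemberY θ.d₆ θ.ℓ₆ θ.hd' θ.hL' θ.b₀ θ.b₁ Mstar, Fintype (geo9Y x).Site] [∀ x : MemberY θ.d₆ θ.ℓ₆ θ.hd' θ.hL' θ.b₀ θ.b₁ Mstar, DecidableEq (geo9Y x).Site]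
    -- row 11: the two input-Hölder leaves (3.44), (3.45) of G′(1) on site arguments (n06-h g3)
    (hGpE4 : AtOneE4On geo9Y (bg9Y (Matrix (Fin N) (Fin N) ℂ) (specialUnitaryUnits (Fin N))) (fun x => ((opsYOfRecord N θ.toStage3Params Mstar 𝔈) x).Gp) (fun _ lam => ¬ (lam.isRight = true)))
    (hGpH2 : AtOneH2On geo9Y (bg9Y (Matrix (Fin N) (Fin N) ℂ) (specialUnitaryUnits (Fin N))) (fun x => ((opsYOfRecord N θ.toStage3Params Mstar 𝔈) x).Gp) (fun _ lam => ¬ (lam.isRight = true)))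
    -- row 13 WHOLE: [B9] Sect. B (3.50)–(3.69) step at the instance (repaired face `SectBFrame₂` in flight, n06-c g4)
    (hB : B9.SectBStepPrinted (θ.d₆ + 1) c35Y geo9Y (bg9Y (Matrix (Fin N) (Fin N) ℂ) (specialUnitaryUnits (Fin N))) (fun x => ((opsYOfRecord N θ.toStage3Params Mstar 𝔈) x).Gp)
      (fun x => ((opsYOfRecord N θ.toStage3Params Mstar 𝔈) x).GA) (fun x => ((opsYOfRecord N θ.toStage3Params Mstar 𝔈) x).Cinv) (fun x => ((opsYOfRecord N θ.toStage3Params Mstar 𝔈) x).IsAnalyticExt))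
    -- rows 15–16: Theorem 3.9's carrier letters on the block carrier `X39`, read by `rd39`; printed-shape schemas; the three pins (n06-j g5)
    {ι39 κ39 : MemberY θ.d₆ θ.ℓ₆ θ.hd' θ.hL' θ.b₀ θ.b₁ Mstar → Type} [∀ x, Fintype (ι39 x)]
    (𝔬39 : ∀ x : MemberY θ.d₆ θ.ℓ₆ θ.hd' θ.hL' θ.b₀ θ.b₁ Mstar,
      Ops39Blk (geo9Y x) (bg9Y (Matrix (Fin N) (Fin N) ℂ) (specialUnitaryUnits (Fin N)) x) (X39 (Matrix (Fin N) (Fin N) ℂ) x.toKIdx) (ι39 x) (κ39 x))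
    (rd39 : ∀ x : MemberY θ.d₆ θ.ℓ₆ θ.hd' θ.hL' θ.b₀ θ.b₁ Mstar, WalkReading39 (bg9Y (Matrix (Fin N) (Fin N) ℂ) (specialUnitaryUnits (Fin N)) x) (ι39 x) (κ39 x))
    (α39 α' r39 δ39 θ39 B39 N39 a39 M39 : ℝ) (h39α : 0 < α39) (h39α1 : α39 < 1) (hα'0 : 0 < α') (hα'1 : α' < 1) (hr39 : 0 < r39) (hrδ39 : r39 ≤ δ39) (hθ39 : 0 ≤ θ39)
    (hB39 : 0 < B39) (hN39 : 0 ≤ N39) (ha39 : 0 < a39) (hM39 : 0 < M39)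
    (hst39 : ∀ x, StaticOK39Blk (𝔬39 x) N39) (hloc39 : ∀ x, Locality39Blk (𝔬39 x) (rd39 x))
    (h39 : ∀ x : MemberY θ.d₆ θ.ℓ₆ θ.hd' θ.hL' θ.b₀ θ.b₁ Mstar, M39 ≤ (geo9Y x).M → ∀ α₀ : ℝ, 0 < α₀ → c35Y * (geo9Y x).M * α₀ ≤ a39 →
      ∀ U : (bg9Y (Matrix (Fin N) (Fin N) ℂ) (specialUnitaryUnits (Fin N)) x).Cfg, (bg9Y (Matrix (Fin N) (Fin N) ℂ) (specialUnitaryUnits (Fin N)) x).Reg335 c35Y α₀ U →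
        Local348Blk (𝔬39 x) B39 δ39 U ∧ Identities395Blk (𝔬39 x) U ∧ Small285Blk (𝔬39 x) θ39 r39 U ∧ Factors389Blk (𝔬39 x) θ39 δ39 U)
    (hblk39 : ∀ x, (𝔬39 x).blk = blk39 (Matrix (Fin N) (Fin N) ℂ) x.toKIdx)
    (hL39 : ∀ x, (𝔬39 x).L = L39 x.toKIdx (lettersYOfRecord N θ.toStage3Params Mstar x).parS (lettersYOfRecord N θ.toStage3Params Mstar x).Gp)
    (hEK39 : ∀ x : MemberY θ.d₆ θ.ℓ₆ θ.hd' θ.hL' θ.b₀ θ.b₁ Mstar, ((opsYOfRecord N θ.toStage3Params Mstar 𝔈) x).EK39 =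
      EK39OfOpsBlkVia (𝔬39 x) (rd39 x) (θ.d₆ + 1)
        (2 * (N39 * B39) * rowConst261 (geo9Y (d := θ.d₆) (ℓ := θ.ℓ₆) (hd := θ.hd') (hL := θ.hL') (b₀ := θ.b₀) (b₁ := θ.b₁) (Mstar := Mstar)) (α' * r39))
        ((1 - α') * r39) (repSite39 x.toKIdx))
    -- row 17: Theorem 3.11's letters with `Inputs311` and the pin of the free predicate letter `PosDef` (sound but PADDED at this instance)
    {E7 F7 W7 : MemberY θ.d₆ θ.ℓ₆ θ.hd' θ.hL' θ.b₀ θ.b₁ Mstar → Type} [∀ x, NormedAddCommGroup (E7 x)] [∀ x, InnerProductSpace ℝ (E7 x)] [∀ x, NormedAddCommGroup (F7 x)]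
    [∀ x, InnerProductSpace ℝ (F7 x)] [∀ x, NormedAddCommGroup (W7 x)] [∀ x, InnerProductSpace ℝ (W7 x)] [∀ x, FiniteDimensional ℝ (W7 x)]
    (𝔬311 : ∀ x : MemberY θ.d₆ θ.ℓ₆ θ.hd' θ.hL' θ.b₀ θ.b₁ Mstar, Ops311 (bg9Y (Matrix (Fin N) (Fin N) ℂ) (specialUnitaryUnits (Fin N)) x) (E7 x) (F7 x) (W7 x))
    (θ311 a311 M311 : ℝ) (ha311 : 0 < a311) (hM311 : 0 < M311)
    (h311 : ∀ x : MemberY θ.d₆ θ.ℓ₆ θ.hd' θ.hL' θ.b₀ θ.b₁ Mstar, M311 ≤ (geo9Y x).M → ∀ α₀ : ℝ, 0 < α₀ → (geo9Y x).M * α₀ ≤ a311 →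
      ∀ U : (bg9Y (Matrix (Fin N) (Fin N) ℂ) (specialUnitaryUnits (Fin N)) x).Cfg, (bg9Y (Matrix (Fin N) (Fin N) ℂ) (specialUnitaryUnits (Fin N)) x).Reg335 c35Y α₀ U → Inputs311 (𝔬311 x) θ311 (geo9Y x).M U)
    (hPD : ∀ x : MemberY θ.d₆ θ.ℓ₆ θ.hd' θ.hL' θ.b₀ θ.b₁ Mstar, ((opsYOfRecord N θ.toStage3Params Mstar 𝔈) x).PosDef = PosDefOfOps (𝔬311 x))
    -- rows 18–19 WHOLE: Thm 3.7, Cor. 3.8, Thm 3.10 and «the random-walk sums yield (3.42)–(3.47)» at the instance (repaired faces: `CoRealizesRel`, n06-l∕n06-k)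
    (t37 : B9.Thm37Printed c35Y geo9Y (bg9Y (Matrix (Fin N) (Fin N) ℂ) (specialUnitaryUnits (Fin N))) (fun x => ((opsYOfRecord N θ.toStage3Params Mstar 𝔈) x).E37))
    (c38 : B9.Cor38Printed c35Y geo9Y (bg9Y (Matrix (Fin N) (Fin N) ℂ) (specialUnitaryUnits (Fin N))) (fun x => ((opsYOfRecord N θ.toStage3Params Mstar 𝔈) x).E37))
    (t310 : B9.Thm310Printed c35Y geo9Y (bg9Y (Matrix (Fin N) (Fin N) ℂ) (specialUnitaryUnits (Fin N))) (fun x => ((opsYOfRecord N θ.toStage3Params Mstar 𝔈) x).E310))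
    (hsum : B9.RWSumsYieldIneqs geo9Y (bg9Y (Matrix (Fin N) (Fin N) ℂ) (specialUnitaryUnits (Fin N))) (fun x => ((opsYOfRecord N θ.toStage3Params Mstar 𝔈) x).E37)
      (fun x => ((opsYOfRecord N θ.toStage3Params Mstar 𝔈) x).E310) (fun x => ((opsYOfRecord N θ.toStage3Params Mstar 𝔈) x).Gp) (fun x => ((opsYOfRecord N θ.toStage3Params Mstar 𝔈) x).GA))
    -- rows 20–21 WHOLE: Thms 3.12–3.13 at the instance (def-Y v2's Sect.-D letters are flat: located-vacuous content here; repaired faces `CoRealizesRel`, n06-l)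
    (t312 : B9.Thm312Printed (θ.d₆ + 1) c35Y geo9Y (bg9Y (Matrix (Fin N) (Fin N) ℂ) (specialUnitaryUnits (Fin N))) (fun x => ((opsYOfRecord N θ.toStage3Params Mstar 𝔈) x).GD)
      (fun x => ((opsYOfRecord N θ.toStage3Params Mstar 𝔈) x).G₁) (fun x => ((opsYOfRecord N θ.toStage3Params Mstar 𝔈) x).H) (fun x => ((opsYOfRecord N θ.toStage3Params Mstar 𝔈) x).H₁)
      (fun x => ((opsYOfRecord N θ.toStage3Params Mstar 𝔈) x).HasRWExp) (fun x => ((opsYOfRecord N θ.toStage3Params Mstar 𝔈) x).HasRWExpH)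
      (fun x => ((opsYOfRecord N θ.toStage3Params Mstar 𝔈) x).PosDefK))
    (t313 : B9.Thm313Printed c35Y geo9Y (bg9Y (Matrix (Fin N) (Fin N) ℂ) (specialUnitaryUnits (Fin N))) (fun x => ((opsYOfRecord N θ.toStage3Params Mstar 𝔈) x).GG)
      (fun x => ((opsYOfRecord N θ.toStage3Params Mstar 𝔈) x).HasRWExp) (fun x => ((opsYOfRecord N θ.toStage3Params Mstar 𝔈) x).PosDefK))
    -- row 24: the two Thm-3.15 expansion-letter slots and the rate (rows 22, 23, 25, 26 hold vacuously at the flat letters, by name below)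
    {δ5 : ℝ} (hδ5 : 0 < δ5)
    (hG5 : ∀ (x : MemberY θ.d₆ θ.ℓ₆ θ.hd' θ.hL' θ.b₀ θ.b₁ Mstar) (U : (bg9Y (Matrix (Fin N) (Fin N) ℂ) (specialUnitaryUnits (Fin N)) x).Cfg), ((opsYOfRecord N θ.toStage3Params Mstar 𝔈) x).GivenBy3185 U)
    (hH5 : ∀ (x : MemberY θ.d₆ θ.ℓ₆ θ.hd' θ.hL' θ.b₀ θ.b₁ Mstar) (U : (bg9Y (Matrix (Fin N) (Fin N) ℂ) (specialUnitaryUnits (Fin N)) x).Cfg), ((opsYOfRecord N θ.toStage3Params Mstar 𝔈) x).HasRWExpC U δ5)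
    (P : B12.RunParams) : Dag.B9_main (leavesP w P) := by
  have t311 := t311_of_pin θ.toStage3Params Mstar (opsYOfRecord N θ.toStage3Params Mstar 𝔈) 𝔬311 θ311 a311 M311 ha311 hM311 h311 hPD
  have t315 := t315_opsYOfRecord_of_slots N θ.toStage3Params Mstar 𝔈 hδ5 hG5 hH5
  have hGp := hGp_opsYOfLetters_of_leaves2 N θ.toStage3Params Mstar (lettersYOfRecord N θ.toStage3Params Mstar) 𝔈 hGpE4 hGpH2
  have hGA := hGA_opsYOfLetters N θ.toStage3Params Mstar (lettersYOfRecord N θ.toStage3Params Mstar) 𝔈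
  obtain ⟨t39, hksum⟩ := t39_hksum_of_pins_opsYOfRecord θ.toStage3Params Mstar 𝔈 𝔬39 rd39 α39 α' r39 δ39 θ39 B39 N39 a39 M39 h39α h39α1 hα'0 hα'1 hr39
    hrδ39 hθ39 hB39 hN39 ha39 hM39 hst39 hloc39 h39 hblk39 hL39 hEK39
  have hE4 := hE4_of_hGA_e4 (opsYOfRecord N θ.toStage3Params Mstar 𝔈) (hGA_e4_opsYOfLetters N θ.toStage3Params Mstar (lettersYOfRecord N θ.toStage3Params Mstar) 𝔈)
  have hH2 := hH2_of_hGA_h2 (opsYOfRecord N θ.toStage3Params Mstar 𝔈) (hGA_h2_opsYOfLetters N θ.toStage3Params Mstar (lettersYOfRecord N θ.toStage3Params Mstar) 𝔈)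
  have hg := hg_obligation_vacuous θ.toStage3Params Mstar (opsYOfRecord N θ.toStage3Params Mstar 𝔈)
  have t314 := t314_opsYOfRecord_vacuous N θ.toStage3Params Mstar 𝔈
  have t314loc := t314loc_opsYOfRecord_vacuous N θ.toStage3Params Mstar 𝔈
  have s349 := s349_opsYOfRecord_vacuous (N := N) θ.toStage3Params Mstar 𝔈 (θ.d₆ + 1) c35Y
  have s3132 := s3132_opsYOfRecord_vacuous (N := N) θ.toStage3Params Mstar 𝔈 (θ.d₆ + 1) c35Y
  exact b9_main_of_up_view₁₁B10YZW_of_obligations θ hθ Mstar (opsYOfRecord N θ.toStage3Params Mstar 𝔈) ζ lamW w hup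
    (hGp_e_opsYOfLetters N θ.toStage3Params Mstar (lettersYOfRecord N θ.toStage3Params Mstar) 𝔈) (hGp_h1_opsYOfLetters N θ.toStage3Params Mstar (lettersYOfRecord N θ.toStage3Params Mstar) 𝔈)
    (hC_opsYOfLetters N θ.toStage3Params Mstar (lettersYOfRecord N θ.toStage3Params Mstar) 𝔈) (hGA_e_opsYOfLetters N θ.toStage3Params Mstar (lettersYOfRecord N θ.toStage3Params Mstar) 𝔈)
    (hGA_h1_opsYOfLetters N θ.toStage3Params Mstar (lettersYOfRecord N θ.toStage3Params Mstar) 𝔈) (hGA_e4_opsYOfLetters N θ.toStage3Params Mstar (lettersYOfRecord N θ.toStage3Params Mstar) 𝔈)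
    (hGA_h2_opsYOfLetters N θ.toStage3Params Mstar (lettersYOfRecord N θ.toStage3Params Mstar) 𝔈) (hGA_l2_opsYOfLetters N θ.toStage3Params Mstar (lettersYOfRecord N θ.toStage3Params Mstar) 𝔈)
    hE4 hH2 hGp hGA hB hg t37 c38 t39 t310 hsum hksum t311 t312 t313 t314 t315 s349 s3132 t314loc P

end Pointed

end Summit.QuantumFields.YangMills.BalabanUVNodes.N06AtOpsYOfRecordSound

end
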